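import Literature.NumberTheory.EllipticCurves.BertoliniDarmonPrasanna2013.WaldspurgerCMSquareFormula
import Literature.NumberTheory.EllipticCurves.BDPCentralValueReciprocity
import Literature.NumberTheory.EllipticCurves.HeegnerPointsImaginaryQuadraticProofs
import Literature.NumberTheory.QuadraticFields.HeegnerCondition
import Literature.NumberTheory.GaloisRepresentations.HeckeCharacterAutConj
import Summits.BirchSwinnertonDyer.BirchSwinnertonDyer.Theorems.ClassRecordThreeOpenValueReciprocityOfBDP
import Summits.BirchSwinnertonDyer.BirchSwinnertonDyer.Theorems.ClassRecordThreeHsiehDescentUnramifiedPeriodItems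
import HarnessLib

/-!
# Routes `ClassRecordThree` ∕ `KolyvaginRoadThree`, item stmt-BirchSwinnertonDyer-19281 `OpenValueReciprocityAtThree`
# (SHARP K5-B): the `Aut(ℂ/H(i))`-reciprocity of `L(f/K,χ,1)/(π^{2n+1}Ω^{4n})` PROVED IN THE KERNEL from the
# explicit Waldspurger formula in square-root form (BDP13 Thm. 5.4 / (5.1.16) + Prop. 1.12 (1))

Cell `bsd-stepL` (run/shared/lean/pub/bsd-stepL/), seat `bsd-stepL-desc3-p1x` (WIDTH-LEVER second prover lane on item
19281, director-bsd g8 2026-08-27), `--supports stmt-BirchSwinnertonDyer-19281`. ROAD W (the road lane A = `desc3-p1` did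
NOT take — its census (β) «verbatim printed facts + kernel derivation: NOT ATTEMPTED»): instead of carrying BDP13's
reciprocity as ONE print-DERIVED named fact (`bertoliniDarmonPrasanna2013_centralValue_reciprocity`, p419864, whose
docstring assembles (D1)–(D6)), take as input only the PRINTED SHAPE of the explicit Waldspurger formula — the Literature
named fact `BertoliniDarmonPrasanna2013.thm54_bdpLalg_eq_sq_sum_cmValues` (BDP13 Thm. 5.4 (5.1.12) / (5.1.16) with
Prop. 1.12 (1): `L_alg(f,χ⁻¹,0) = (∑_𝔞 χ_j(𝔞)⁻¹·V_𝔞)²` with `χ`-FREE `V_𝔞` in `H(i)`, typed in bsd-eis's verbatim BDP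
display currency `bdpLalg` / `heckeIdealValueExtZero`) — and do the Galois bookkeeping IN THE KERNEL:

* §1 `autConjType_eq_of_forall_apply_eq`, `hasInfinityType_autConj_of_forall_apply_eq` — Weil's conjugate `^σχ`
  (`HasInfinityType.autConj`) has the SAME type `(n, −n)` when `σ` fixes both complex embeddings of the (totally
  complex) field `K` ((D4): "`σ` fixes `K ⊂ H` so the type is kept").
* §2 `map_heckeIdealValueExtZero_autConj` — `σ(χ(𝔞)) = (^σχ)(𝔞)` on IDEAL values ((D4); the prime case is x11b3's
  `Three.algEquiv_apply_heckeValueExtZero`, reused); `heckeIdealValueExtZero_ne_zero`.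
* §3 `map_sqrt_abs_discr` — `σ(√|d_K|) = √|d_K|` for `σ` fixing `K` and `i` ((D5): `|d_K|^{1/2} = ∓ i·√d_K`).
* §4 `map_bdpConstW_autConj` — `σ(w(f,χ)) = w(f,^σχ)` from (5.1.11) (BDP Lemma 5.3 (3), here a theorem);
  `rankinSelberg_div_eq_bdpLalg_mul` — the constants undone: `L(f/K,φ,1)/(π^{2n+1}Ω'^{4n}) =
  L_alg·w(f,χ)·4/(Γ(n)Γ(n+1)·w_K·√|d_K|·2^{#S(f)})` with `Ω' = Ω·(√|d_K|/2)^{1/2}/π` ((D5): the `π`/`vol(𝒪_K)`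
  monomial absorbed into the period, exactly).
* §5 **`bdp2013_centralValue_reciprocity_of_waldspurgerSq`** — the square-root formula IMPLIES the tree's reciprocity
  fact `bertoliniDarmonPrasanna2013_centralValue_reciprocity` (p419864's `Prop`, = the registered stub
  `stub_bdpCentralValueReciprocity` of 19281's skeleton `LineArchimedeanBDP`).
* §6 `openValueReciprocityAtThree_of_waldspurgerSq` (+ `KolyvaginRoadThree` copy, + by-name `ValueReciprocityBAtThree`)
  — **item 19281 from the square-root formula** (via lane A's p421735 ← p420148); and the parent crux 19108
  `HsiehDescentAtThree` from {square-root formula, Hsieh 2014 Thm. 5.6 with `Ω_p ∈ 𝒲^×`} (via lane A's p451946).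

HONEST FRAMING: CONDITIONAL results — the square-root formula is a PUBLISHED theorem carried as a named fact (its
discharge needs CM test triples and Shimura's algebraicity of nearly-holomorphic CM values, a definition front absent
from the tree); items 19281 ∕ 19108 are NOT closed by these theorems (conditional-result); nothing booked (T7); BSD is
not proved by any of this. NET EFFECT on the trust base of K5-B: the print-derivation steps (D1) (dictionary, inherited
from bsd-eis's page-certified `bdpLalg`), (D2) (`L`-value), (D4) (equivariance), (D5) (constants) of p419864 are now
kernel theorems; what remains cited is the printed shape (5.1.16), Prop. 1.12 (1), and the field description
(D3)/(D6) (`V_𝔞 ∈ H`, `H(i)` unramified above odd primes unramified in `K`). On the director's literal pointer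
(Castella–Hsieh branch value, p507031): inapplicable on this locus (`¬ p ∣ N` vs `3 ∣ N` for class X11b at 3; value at
the genus character `n = 0`; an `R₀`-frame yields inertial reciprocity only) — the in-tree "explicit special value" that
does the work is BDP's own display `bdpLalg`.

References: [BertoliniDarmonPrasanna2013] Prop. 1.12 (1), (4.1.3), Thm. 4.6, (5.1.6), Lemma 5.2, (5.1.11), Lemma 5.3,
Thm. 5.4 (5.1.12), (5.1.15), Thm. 5.5, (5.1.16); [Weil1956] §1; [Hsieh2014] Thm. 5.6; cell files TARGET §1.1 (R-b),
PROOF-BDP §18/§27, lane A HANDOFF §§ desc3-p1 g0–g6.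
-/

noncomputable section

open scoped NumberField BigOperators
open NumberField IsDedekindDomain
open Literature.NumberTheory.GaloisRepresentations
open Literature.NumberTheory.EllipticCurves
open Literature.NumberTheory.EllipticCurves.ModularForms
open Literature.NumberTheory.EllipticCurves.BertoliniDarmonPrasanna2013
open Summit.BirchSwinnertonDyer.Rank1Residual.X11b.Three (algEquiv_apply_heckeValueExtZero)

namespace Summit.BirchSwinnertonDyer.BirchSwinnertonDyer.Theorems

namespace WaldspurgerReciprocity

variable {K : Type} [Field K] [NumberField K]

/-! ### 1. The conjugate type `^σ(p,q)` is `(p,q)` when `σ` fixes every complex embedding of a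
totally complex field -/

omit [NumberField K] in
/-- If `K` is totally complex and `σ ∈ Aut(ℂ)` fixes `e(K)` pointwise for every embedding
`e : K → ℂ`, then the conjugate infinity type `^σ(p, q)` is `(p, q)`. [folklore] -/
theorem autConjType_eq_of_forall_apply_eq [IsTotallyComplex K] (σ : ℂ ≃ₐ[ℚ] ℂ)
    (hσ : ∀ (e : K →+* ℂ) (k : K), σ (e k) = e k) (p q : InfinitePlace K → ℤ) :
    HeckeCharacter.autConjType σ p q = (p, q) := by
  have hcomp : ∀ e : K →+* ℂ,
      ((σ.symm : ℂ ≃ₐ[ℚ] ℂ).toAlgHom.toRingHom.comp e) = e := by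
    intro e
    ext k
    change σ.symm (e k) = e k
    conv_lhs => rw [← hσ e k]
    exact σ.symm_apply_apply (e k)
  have hnr : ∀ w : InfinitePlace K, ¬ w.IsReal := fun w ↦
    InfinitePlace.not_isReal_iff_isComplex.mpr (IsTotallyComplex.isComplex w)
  unfold HeckeCharacter.autConjType HeckeCharacter.typeOfExponent
  simp only [hcomp]
  refine Prod.ext ?_ ?_
  · funext w
    have h1 : ¬ ComplexEmbedding.IsReal w.embedding := fun h ↦ hnr w (InfinitePlace.isReal_iff.mpr h)
    simp only [HeckeCharacter.embExponent, h1, if_false, InfinitePlace.mk_embedding, if_true]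
  · funext w
    have h1 : ¬ ComplexEmbedding.IsReal w.embedding := fun h ↦ hnr w (InfinitePlace.isReal_iff.mpr h)
    have h2 : ¬ ComplexEmbedding.IsReal (ComplexEmbedding.conjugate w.embedding) := fun h ↦
      h1 (ComplexEmbedding.isReal_conjugate_iff.mp h)
    have h3 : ComplexEmbedding.conjugate w.embedding ≠
        (InfinitePlace.mk (ComplexEmbedding.conjugate w.embedding)).embedding := by
      rw [InfinitePlace.mk_conjugate_eq, InfinitePlace.mk_embedding]
      intro h
      exact h1 (ComplexEmbedding.isReal_iff.mpr h)
    simp only [HeckeCharacter.embExponent, hnr w, if_false, h2]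
    rw [if_neg h3, InfinitePlace.mk_conjugate_eq, InfinitePlace.mk_embedding]

/-- For an imaginary quadratic `K` and `σ ∈ Aut(ℂ)` fixing both complex embeddings of `K`
pointwise, the conjugate `^σχ` of a Hecke character of type `(n, -n)` has type `(n, -n)` again
(Weil 1956). [folklore] -/
theorem hasInfinityType_autConj_of_forall_apply_eq [IsTotallyComplex K] {χ : HeckeCharacter K}
    {p q : InfinitePlace K → ℤ} (hχ : χ.HasInfinityType p q) (σ : ℂ ≃ₐ[ℚ] ℂ)
    (hσ : ∀ (e : K →+* ℂ) (k : K), σ (e k) = e k) :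
    (hχ.autConj σ).HasInfinityType p q := by
  have h := hχ.hasInfinityType_autConj σ
  rw [autConjType_eq_of_forall_apply_eq σ hσ p q] at h
  exact h

/-! ### 2. `σ` on the ideal values `χ(𝔞)` -/

/-- `σ(χ(𝔞)) = (^σχ)(𝔞)` for the ideal values extended by zero (BDP (4.1.5)). [folklore] -/
theorem map_heckeIdealValueExtZero_autConj {χ : HeckeCharacter K} {p q : InfinitePlace K → ℤ}
    (hχ : χ.HasInfinityType p q) (σ : ℂ ≃ₐ[ℚ] ℂ) (𝔞 : Ideal (𝓞 K)) :
    σ (heckeIdealValueExtZero χ 𝔞) = heckeIdealValueExtZero (hχ.autConj σ) 𝔞 := by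
  unfold heckeIdealValueExtZero
  rw [show (σ : ℂ → ℂ) = (σ : ℂ ≃* ℂ) from rfl, MulEquiv.map_finprod]
  refine finprod_congr fun v ↦ ?_
  rw [map_pow]
  change σ (heckeValueExtZero χ v) ^ _ = _
  rw [algEquiv_apply_heckeValueExtZero hχ σ v]

/-- The ideal value `χ(𝔞)` of an everywhere unramified character at a non-zero ideal is non-zero
(a product of values at uniformizers, which are units). [folklore] -/
theorem heckeIdealValueExtZero_ne_zero {χ : HeckeCharacter K}
    (hunr : ∀ v : HeightOneSpectrum (𝓞 K), χ.IsUnramifiedAt v) {𝔞 : Ideal (𝓞 K)} (h𝔞 : 𝔞 ≠ ⊥) :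
    heckeIdealValueExtZero χ 𝔞 ≠ 0 := by
  have hfin := Ideal.finite_factors h𝔞
  rw [heckeIdealValueExtZero_eq_prod χ h𝔞 hfin.toFinset (fun v hv ↦ hfin.mem_toFinset.mpr hv)]
  refine Finset.prod_ne_zero_iff.mpr fun v _ ↦ pow_ne_zero _ ?_
  rw [heckeValueExtZero_of_isUnramifiedAt (hunr v), HeckeCharacter.valueAtUniformizer]
  exact Units.ne_zero _

/-! ### 3. `σ` fixes `√|d_K|` when it fixes `K` and `i` -/

/-- For an imaginary quadratic `K`: if `σ ∈ Aut(ℂ)` fixes every `e(K)` pointwise and fixes `i`,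
then `σ(√|d_K|) = √|d_K|` — indeed `√|d_K| = ∓ i · e(√d_K)` with `√d_K ∈ K`. [folklore] -/
theorem map_sqrt_abs_discr (hK : IsImaginaryQuadratic K) (σ : ℂ ≃ₐ[ℚ] ℂ)
    (hσ : ∀ (e : K →+* ℂ) (k : K), σ (e k) = e k) (hI : σ Complex.I = Complex.I) :
    σ (Real.sqrt |(NumberField.discr K : ℝ)| : ℂ) = (Real.sqrt |(NumberField.discr K : ℝ)| : ℂ) := by
  obtain ⟨-, -, δ, -, hδ⟩ :=
    Literature.NumberTheory.QuadraticFields.Quadratic.exists_sq_eq_discr (K := K) hK.1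
  have hneg : (NumberField.discr K : ℝ) < 0 := by exact_mod_cast hK.discr_neg
  set s : ℝ := Real.sqrt |(NumberField.discr K : ℝ)| with hs
  have hs2 : (s : ℂ) ^ 2 = -(NumberField.discr K : ℂ) := by
    rw [← Complex.ofReal_pow, hs, Real.sq_sqrt (abs_nonneg _), abs_of_neg hneg]
    push_cast
    ring
  -- an embedding of `K`
  obtain ⟨w⟩ := (inferInstance : Nonempty (InfinitePlace K))
  set e : K →+* ℂ := w.embedding
  set z : ℂ := e (δ : K) with hz
  have hδK : ((δ : K)) ^ 2 = (NumberField.discr K : K) := by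
    have h := congrArg (fun x : 𝓞 K ↦ (x : K)) hδ
    simpa using h
  have hz2 : z ^ 2 = (NumberField.discr K : ℂ) := by
    rw [hz, ← map_pow, hδK, map_intCast]
  have hsq : (Complex.I * (s : ℂ)) ^ 2 = z ^ 2 := by
    rw [mul_pow, Complex.I_sq, hs2, hz2]; ring
  have hσz : σ z = z := hσ e _
  rcases eq_or_eq_neg_of_sq_eq_sq _ _ hsq with h | h
  · -- `i s = z`
    have : (s : ℂ) = -Complex.I * z := by
      rw [← h]; ring_nf; rw [Complex.I_sq]; ring
    rw [this, map_mul, map_neg, hI, hσz]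
  · have : (s : ℂ) = Complex.I * z := by
      have h' : Complex.I * (s : ℂ) = -z := h
      calc (s : ℂ) = -Complex.I * (Complex.I * (s : ℂ)) := by
            ring_nf; rw [Complex.I_sq]; ring
        _ = Complex.I * z := by rw [h']; ring
    rw [this, map_mul, hI, hσz]

/-! ### 4. Undoing BDP's constants -/

/-- `σ(w(f,χ)) = w(f,^σχ)` for `σ` fixing `w_f` and `b_N` (BDP Lemma 5.3 (3) at `k = 2`, `ε_f = 𝟙`,
from the explicit formula (5.1.11)). [folklore] -/
theorem map_bdpConstW_autConj {χ : HeckeCharacter K} {p q : InfinitePlace K → ℤ}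
    (hχ : χ.HasInfinityType p q) (σ : ℂ ≃ₐ[ℚ] ℂ) {wf bN : ℂ} (hwf : σ wf = wf) (hbN : σ bN = bN)
    (𝔟 : Ideal (𝓞 K)) (N₀ n : ℕ) :
    σ (bdpConstW wf χ 𝔟 N₀ bN n) = bdpConstW wf (hχ.autConj σ) 𝔟 N₀ bN n := by
  unfold bdpConstW
  simp only [map_mul, map_pow, map_zpow₀, map_neg, map_natCast, hwf, hbN,
    map_heckeIdealValueExtZero_autConj hχ σ]

/-- **The constants undone.** With `Ω' := Ω·(√|d_K|/2)^{1/2}/π` (so `Ω'^4 = Ω^4·|d_K|/(4π^4)`):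
`L(f/K,φ,1)/(π^{2n+1}Ω'^{4n}) = L_alg · w(f,χ) · 4/(Γ(n)Γ(n+1)·w_K·√|d_K|·2^{#S(f)})` — pure algebra
on BDP's `C(f,χ,1) = ¼π^{2n−1}Γ(n)Γ(n+1)w_K√|d_K|(√|d_K|/2)^{−2n}2^{#S(f)}` (Thm. 4.6) and
`L_alg = w⁻¹·C·L/Ω^{4n}` (Thm. 5.5). [folklore] -/
theorem rankinSelberg_div_eq_bdpLalg_mul {N : ℕ} (f : CuspForm (CongruenceSubgroup.Gamma0 N) 2)
    (sf : ℕ) {wf bN Ω : ℂ} (𝔟 : Ideal (𝓞 K)) (N₀ : ℕ) (hΩ : Ω ≠ 0)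
    (hd : NumberField.discr K ≠ 0) {φ : HeckeCharacter K} {n : ℕ} (hn : 0 < n)
    (hW : bdpConstW wf φ 𝔟 N₀ bN n ≠ 0) :
    rankinSelbergValueHecke f φ 1 /
        ((Real.pi : ℂ) ^ (2 * n + 1) *
          (Ω * (Real.sqrt (Real.sqrt |(NumberField.discr K : ℝ)| / 2) : ℂ) / (Real.pi : ℂ)) ^ (4 * n)) =
      bdpLalg f sf wf 𝔟 N₀ bN Ω φ n * bdpConstW wf φ 𝔟 N₀ bN n *
        (4 / (Complex.Gamma n * Complex.Gamma (n + 1) * (Units.torsionOrder K : ℂ) *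
          (Real.sqrt |(NumberField.discr K : ℝ)| : ℂ) * 2 ^ sf)) := by
  obtain ⟨m, rfl⟩ : ∃ m, n = m + 1 := ⟨n - 1, by omega⟩
  set s : ℝ := Real.sqrt |(NumberField.discr K : ℝ)| with hs
  have hs0 : 0 < s := Real.sqrt_pos.mpr (abs_pos.mpr (by exact_mod_cast hd))
  set r : ℝ := Real.sqrt (s / 2) with hr
  have hr0 : 0 < r := Real.sqrt_pos.mpr (by positivity)
  have hr2 : (r : ℂ) ^ 2 = (s : ℂ) / 2 := by
    rw [← Complex.ofReal_pow, hr, Real.sq_sqrt (by positivity)]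
    push_cast
    ring
  have hr4 : (r : ℂ) ^ (4 * (m + 1)) = ((s : ℂ) / 2) ^ (2 * (m + 1)) := by
    rw [show 4 * (m + 1) = 2 * (2 * (m + 1)) by ring, pow_mul, hr2]
  have hsC : (s : ℂ) ≠ 0 := Complex.ofReal_ne_zero.mpr hs0.ne'
  have hrC : (r : ℂ) ≠ 0 := Complex.ofReal_ne_zero.mpr hr0.ne'
  have hπ : (Real.pi : ℂ) ≠ 0 := Complex.ofReal_ne_zero.mpr Real.pi_ne_zero
  have hΓ1 : Complex.Gamma ((m + 1 : ℕ) : ℂ) ≠ 0 := by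
    rw [Nat.cast_succ, Complex.Gamma_nat_eq_factorial]
    exact_mod_cast Nat.factorial_ne_zero m
  have hΓ2 : Complex.Gamma (((m + 1 : ℕ) : ℂ) + 1) ≠ 0 := by
    rw [Complex.Gamma_nat_eq_factorial]
    exact_mod_cast Nat.factorial_ne_zero (m + 1)
  have hwK : (Units.torsionOrder K : ℂ) ≠ 0 := by exact_mod_cast (Units.torsionOrder_pos K).ne'
  have hzp : ((s : ℂ) / 2) ^ (-(2 * ((m + 1 : ℕ) : ℤ))) = (((s : ℂ) / 2) ^ (2 * (m + 1)))⁻¹ := by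
    rw [zpow_neg, show (2 * ((m + 1 : ℕ) : ℤ)) = ((2 * (m + 1) : ℕ) : ℤ) by push_cast; ring,
      zpow_natCast]
  unfold bdpLalg bdpConstC
  rw [hzp, show 2 * (m + 1) - 1 = 2 * m + 1 by omega, div_pow, mul_pow, hr4]
  field_simp
  ring

/-! ### 5. The reciprocity law from the square-root formula -/

/-- **BDP13's `Aut(ℂ/H(i))`-reciprocity of `L(f/K,χ,1)/(π^{2n+1}Ω^{4n})` (the tree's named fact
`bertoliniDarmonPrasanna2013_centralValue_reciprocity`, p419864) FOLLOWS from the explicit Waldspurger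
formula in square-root form (BDP13 Thm. 5.4 / (5.1.16) + Prop. 1.12 (1)).** Proof = the Galois
bookkeeping (D4)–(D5) of that fact's docstring, now in the kernel: apply `σ` to
`L_alg(χ) = (∑ χ_j(𝔞)⁻¹ V_𝔞)²`, move `σ` inside (`σ V_𝔞 = V_𝔞`, `σ(χ_j(𝔞)) = (^σχ)_j(𝔞)` by Weil), recognise
`L_alg(^σχ)` (the formula at `^σχ`, of the same type since `σ` fixes `K`), and undo the constants `w(f,χ)`
(`σ w(f,χ) = w(f,^σχ)`) and `C(f,χ,1)` (`σ √|d_K| = √|d_K|` as `σ i = i`), with the period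
`Ω' = Ω·(√|d_K|/2)^{1/2}/π`. [cite: BertoliniDarmonPrasanna2013, Thm. 5.4 (5.1.12), (5.1.16), Thm. 5.5 (pp. 59–60)] -/
theorem bdp2013_centralValue_reciprocity_of_waldspurgerSq (hX : thm54_bdpLalg_eq_sq_sum_cmValues) :
    bertoliniDarmonPrasanna2013_centralValue_reciprocity := by
  intro W _ K _ _ N _ f hnf hN hK hodd hHeeg
  obtain ⟨Ω, wf, bN, 𝔟, sf, F, hΩ, hwf, hbN, h𝔟, hFfin, hKF, hIF, hwfF, hbNF, hram, hsq⟩ :=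
    hX W K f hnf hN hK hodd hHeeg
  haveI : IsTotallyComplex K := hK.2
  have hd : NumberField.discr K ≠ 0 := hK.discr_neg.ne
  -- the rescaled period
  set r : ℝ := Real.sqrt (Real.sqrt |(NumberField.discr K : ℝ)| / 2) with hr
  have hr0 : 0 < r :=
    Real.sqrt_pos.mpr (by
      have : 0 < Real.sqrt |(NumberField.discr K : ℝ)| :=
        Real.sqrt_pos.mpr (abs_pos.mpr (by exact_mod_cast hd))
      positivity)
  have hπ : (Real.pi : ℂ) ≠ 0 := Complex.ofReal_ne_zero.mpr Real.pi_ne_zero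
  have hΩ' : Ω * (r : ℂ) / (Real.pi : ℂ) ≠ 0 :=
    div_ne_zero (mul_ne_zero hΩ (Complex.ofReal_ne_zero.mpr hr0.ne')) hπ
  refine ⟨Ω * (r : ℂ) / (Real.pi : ℂ), F, hΩ', hFfin, hKF, hram, ?_⟩
  intro σ hσ χ n hn hunr hχ
  obtain ⟨A, V, hV, hform⟩ := hsq n hn
  have hσK : ∀ (e : K →+* ℂ) (k : K), σ (e k) = e k := fun e k ↦ hσ _ (hKF e k)
  have hσI : σ Complex.I = Complex.I := hσ _ hIF
  -- the conjugate character is again in the range of the formula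
  have hχσ_type : (hχ.autConj σ).HasInfinityType (fun _ ↦ (n : ℤ)) (fun _ ↦ -(n : ℤ)) :=
    hasInfinityType_autConj_of_forall_apply_eq hχ σ hσK
  have hχσ_unr : ∀ v : HeightOneSpectrum (𝓞 K), (hχ.autConj σ).IsUnramifiedAt v := fun v ↦
    (hχ.isUnramifiedAt_autConj_iff σ v).mpr (hunr v)
  have h1 := hform χ hunr hχ
  have h2 := hform (hχ.autConj σ) hχσ_unr hχσ_type
  -- non-vanishing of `w(f,χ)` and `w(f,^σχ)`
  have hN0 : (N : ℂ) ≠ 0 := by exact_mod_cast (NeZero.ne N)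
  have hWne : ∀ {ψ : HeckeCharacter K}, (∀ v : HeightOneSpectrum (𝓞 K), ψ.IsUnramifiedAt v) →
      bdpConstW wf ψ 𝔟 N bN n ≠ 0 := by
    intro ψ hψ
    unfold bdpConstW
    refine mul_ne_zero (mul_ne_zero (mul_ne_zero hwf (mul_ne_zero
      (heckeIdealValueExtZero_ne_zero hψ h𝔟) (pow_ne_zero _ ?_))) (pow_ne_zero _ (neg_ne_zero.mpr hN0)))
      (zpow_ne_zero _ hbN)
    exact_mod_cast (Ideal.absNorm_eq_zero_iff.not.mpr h𝔟)
  rw [rankinSelberg_div_eq_bdpLalg_mul f sf 𝔟 N hΩ hd hn (hWne hunr),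
    rankinSelberg_div_eq_bdpLalg_mul f sf 𝔟 N hΩ hd hn (hWne hχσ_unr), h1, h2, map_mul, map_mul,
    map_bdpConstW_autConj hχ σ (hσ _ hwfF) (hσ _ hbNF)]
  -- the rational constant `4/(Γ(n)Γ(n+1) w_K √|d_K| 2^{#S(f)})` is fixed by `σ`
  have hconst : σ (4 / (Complex.Gamma n * Complex.Gamma (n + 1) * (Units.torsionOrder K : ℂ) *
      (Real.sqrt |(NumberField.discr K : ℝ)| : ℂ) * 2 ^ sf)) =
      4 / (Complex.Gamma n * Complex.Gamma (n + 1) * (Units.torsionOrder K : ℂ) *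
        (Real.sqrt |(NumberField.discr K : ℝ)| : ℂ) * 2 ^ sf) := by
    obtain ⟨m, rfl⟩ : ∃ m, n = m + 1 := ⟨n - 1, by omega⟩
    have hG1 : Complex.Gamma ((m + 1 : ℕ) : ℂ) = (m.factorial : ℂ) := by
      rw [Nat.cast_succ, Complex.Gamma_nat_eq_factorial]
    have hG2 : Complex.Gamma (((m + 1 : ℕ) : ℂ) + 1) = ((m + 1).factorial : ℂ) := by
      rw [Complex.Gamma_nat_eq_factorial]
    rw [hG1, hG2]
    simp only [map_div₀, map_mul, map_pow, map_natCast, map_ofNat, map_sqrt_abs_discr hK σ hσK hσI]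
  rw [hconst, map_pow, map_sum]
  congr 3
  refine Finset.sum_congr rfl fun 𝔞 h𝔞 ↦ ?_
  rw [map_mul, map_inv₀, map_mul, map_pow, map_natCast, map_heckeIdealValueExtZero_autConj hχ σ,
    hσ _ (hV 𝔞 h𝔞)]

end WaldspurgerReciprocity

/-! ### 6. Item 19281 and its parent 19108 from the square-root formula -/

open WaldspurgerReciprocity

/-- **Item `stmt-BirchSwinnertonDyer-19281` (`Theses.ClassRecordThree.OpenValueReciprocityAtThree`, SHARP K5-B)
from the explicit Waldspurger formula in square-root form** (BDP13 Thm. 5.4 / (5.1.16) + Prop. 1.12 (1),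
the Literature named fact), by `bdp2013_centralValue_reciprocity_of_waldspurgerSq` and lane A's composition
`openValueReciprocityAtThree_of_bdp2013` (p421735 ← p420148: T6-OPEN + the value dictionary). CONDITIONAL on
that fact; the item is NOT closed by this theorem (conditional-result).
[cite: BertoliniDarmonPrasanna2013, Thm. 5.4 (5.1.12) and (5.1.16) (pp. 59–60)] -/
theorem openValueReciprocityAtThree_of_waldspurgerSq (hX : thm54_bdpLalg_eq_sq_sum_cmValues) :
    Summit.BirchSwinnertonDyer.BirchSwinnertonDyer.Theses.ClassRecordThree.OpenValueReciprocityAtThree :=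
  openValueReciprocityAtThree_of_bdp2013 (bdp2013_centralValue_reciprocity_of_waldspurgerSq hX)

/-- **The `KolyvaginRoadThree` copy of item 19281 from the square-root formula** (same proposition,
shared item). [cite: BertoliniDarmonPrasanna2013, Thm. 5.4 (5.1.12) and (5.1.16) (pp. 59–60)] -/
theorem kolyvaginRoadThree_openValueReciprocityAtThree_of_waldspurgerSq (hX : thm54_bdpLalg_eq_sq_sum_cmValues) :
    Summit.BirchSwinnertonDyer.BirchSwinnertonDyer.Theses.KolyvaginRoadThree.OpenValueReciprocityAtThree :=
  kolyvaginRoadThree_openValueReciprocityAtThree_of_bdp2013 (bdp2013_centralValue_reciprocity_of_waldspurgerSq hX)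

/-- **By name: `∀ W, Theorems.ValueReciprocityBAtThree W` (bdp g10's SHARP K5-B binder, p417714) from the
square-root formula.** [cite: BertoliniDarmonPrasanna2013, Thm. 5.4 (5.1.12) and (5.1.16) (pp. 59–60)] -/
theorem valueReciprocityBAtThree_of_waldspurgerSq (hX : thm54_bdpLalg_eq_sq_sum_cmValues) (W : WeierstrassCurve ℚ) [W.IsElliptic]
    [W.IsGloballyMinimal] : ValueReciprocityBAtThree W :=
  valueReciprocityBAtThree_of_bdp2013 (bdp2013_centralValue_reciprocity_of_waldspurgerSq hX) W

/-- **The parent crux `HsiehDescentAtThree` (item stmt-BirchSwinnertonDyer-19108) from exactly TWO Literature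
named facts, both now VERBATIM-SHAPE statements about `L`-functions:** the square-root Waldspurger formula
(BDP13 (5.1.16)) and Hsieh 2014 Thm. 5.6 with `Ω_p ∈ 𝒲^×` (`hsieh2014_exists_anticyclotomicPAdicLFunction_unrPeriod`,
lane A p451301) — via lane A's Tate–Sen-free descent `classRecordThree_hsiehDescentAtThree_of_bdp2013_of_hsieh2014_unrPeriod`
(p451946). CONDITIONAL on both; item 19108 is NOT closed by this theorem.
[cite: BertoliniDarmonPrasanna2013, (5.1.16) (p. 60)] [cite: Hsieh2014, Thm. 5.6] -/
theorem classRecordThree_hsiehDescentAtThree_of_waldspurgerSq_of_hsieh2014_unrPeriod (hX : thm54_bdpLalg_eq_sq_sum_cmValues)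
    (hH : hsieh2014_exists_anticyclotomicPAdicLFunction_unrPeriod) :
    Summit.BirchSwinnertonDyer.BirchSwinnertonDyer.Theses.ClassRecordThree.HsiehDescentAtThree :=
  classRecordThree_hsiehDescentAtThree_of_bdp2013_of_hsieh2014_unrPeriod
    (bdp2013_centralValue_reciprocity_of_waldspurgerSq hX) hH

/-- **The `KolyvaginRoadThree` copy of the parent crux from the same two facts.**
[cite: BertoliniDarmonPrasanna2013, (5.1.16) (p. 60)] [cite: Hsieh2014, Thm. 5.6] -/
theorem kolyvaginRoadThree_hsiehDescentAtThree_of_waldspurgerSq_of_hsieh2014_unrPeriod (hX : thm54_bdpLalg_eq_sq_sum_cmValues)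
    (hH : hsieh2014_exists_anticyclotomicPAdicLFunction_unrPeriod) :
    Summit.BirchSwinnertonDyer.BirchSwinnertonDyer.Theses.KolyvaginRoadThree.HsiehDescentAtThree :=
  kolyvaginRoadThree_hsiehDescentAtThree_of_bdp2013_of_hsieh2014_unrPeriod
    (bdp2013_centralValue_reciprocity_of_waldspurgerSq hX) hH

end Summit.BirchSwinnertonDyer.BirchSwinnertonDyer.Theorems

end
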